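import Literature.ModelTheory.FiniteModelTheory.CPTCardPTIMECensus
import HarnessLib

/-!
# Simulating BGS programs in polynomial time, IV: the size analysis (no overflow)

Topic `Literature/ModelTheory/FiniteModelTheory`; fourth support file of the discharge of
`Literature.ModelTheory.FiniteModelTheory.CPTCardInPTIME`. This is the quantitative heart of
Blass–Gurevich–Shelah 1999, §5.2 Theorem 1: "The bound `r` in a term `{s(v) : v ∈ r : g(v)}` and in
a do-forall rule ensures that the number of immediate subcomputations is bounded … This yields a
polynomial bound on the work needed to simulate one transition in the run. Since the number of
transitions is bounded by `p(n)`, the whole simulation takes only polynomial time." For the guarded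
simulation `runP` of `CPTCardPTIMECensus.lean` it takes the form: **with the budget
`B = budget P n` (an explicit polynomial expression in `n`, `p(n)`, `q(n)`), the overflow flag is
never raised** (`runP_flag`), so that `runP_sound` applies unconditionally.

* HEREDITARY WIDTH `HF.hw x` — the largest number of members of `x` or of a hereditary member of
  `x`. Active objects have width at most the number of active objects (`hw_le_of_active`); the
  width of the value of a term is bounded by `wB t` applied to a bound on the widths of the
  environment and of the state (`hw_eval_le`) — BGS's remark made precise: with the printed
  definition of "active", an unstored intermediate range need not consist of active objects, but
  its size is polynomial in the number of active objects, uniformly in the state;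
* the COUNTS `cntT`/`cntA`/`cntR` of table entries a term / argument list / rule may add, the
  update count `ucnt`, and the GUARD BOUNDS `gdT`/`gdA`/`gdR` (the largest measure met by a guard),
  all by structural recursion; the closed forms `szB`, `tabB`, … bounding the code lengths `cL`,
  `cT`, … of canonical data;
* `noOvf_ev` / `noOvf_den` (flag stays down and the table grows by at most the count, whenever the
  budget dominates the guard bound), `round`/`run` bookkeeping, and `runP_flag`.

## References

* A. Blass, Y. Gurevich, S. Shelah, *Choiceless polynomial time*, Ann. Pure Appl. Logic 100
  (1999) = arXiv:math/9705225, §5.2 Theorem 1 and its proof; §5.1.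
-/

noncomputable section

namespace Literature.ModelTheory.FiniteModelTheory

/-! ### Hereditary width -/

namespace HF

variable {α : Type*}

/-- The HEREDITARY WIDTH of an object: the largest number of members of the object itself or of
one of its hereditary members. [folklore] -/
def hw (x : HF α) : ℕ := (insert x (tc x)).sup fun y => y.members.card

/-- Characterisation of `hw x ≤ D`. [folklore] -/
theorem hw_le_iff {x : HF α} {D : ℕ} :
    hw x ≤ D ↔ x.members.card ≤ D ∧ ∀ y ∈ tc x, y.members.card ≤ D := by
  rw [hw, Finset.sup_le_iff]
  simp only [Finset.mem_insert, forall_eq_or_imp]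

/-- An object has at most `hw` members. [folklore] -/
theorem card_members_le_hw (x : HF α) : x.members.card ≤ hw x :=
  (hw_le_iff.mp le_rfl).1

/-- Hereditary members are not wider. [folklore] -/
theorem hw_le_of_mem_tc {x y : HF α} (h : y ∈ tc x) : hw y ≤ hw x := by
  obtain ⟨h1, h2⟩ := hw_le_iff.mp (le_refl (hw x))
  exact hw_le_iff.mpr ⟨h2 y h, fun z hz => h2 z (tc_subset_tc_of_mem_tc h hz)⟩

/-- Members are not wider. [folklore] -/
theorem hw_le_of_mem {x y : HF α} (h : y ∈ x) : hw y ≤ hw x := hw_le_of_mem_tc (mem_tc_of_mem h)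

/-- Bounding the width of a set by its number of members and the widths of its members.
[folklore] -/
theorem hw_le_of_forall_mem {x : HF α} {D : ℕ} (h1 : x.members.card ≤ D) (h2 : ∀ y ∈ x, hw y ≤ D) :
    hw x ≤ D := by
  refine hw_le_iff.mpr ⟨h1, fun y hy => ?_⟩
  obtain ⟨w, hw', h⟩ := mem_tc_iff.mp hy
  rcases h with rfl | h
  · exact (card_members_le_hw y).trans (h2 y hw')
  · exact (card_members_le_hw y).trans ((hw_le_of_mem_tc h).trans (h2 w hw'))

/-- Atoms have width `0`. [folklore] -/
@[simp] theorem hw_atom (a : α) : hw (atom a) = 0 := by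
  apply Nat.eq_zero_of_le_zero
  exact hw_le_iff.mpr ⟨by simp, fun y hy => by simp at hy⟩

/-- `∅` has width `0`. [folklore] -/
@[simp] theorem hw_empty : hw (∅ : HF α) = 0 := by
  apply Nat.eq_zero_of_le_zero
  exact hw_le_of_forall_mem (by simp) fun y hy => (not_mem_empty y hy).elim

/-- The von Neumann ordinal `k` has width at most `k`. [folklore] -/
theorem hw_ordinal_le : ∀ k : ℕ, hw (ordinal k : HF α) ≤ k
  | k => by
    refine hw_le_of_forall_mem (card_members_ordinal k).le fun y hy => ?_
    obtain ⟨m, hm, rfl⟩ := mem_ordinal_iff.mp hy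
    exact (hw_ordinal_le m).trans hm.le

/-- Truth values have width at most `1`. [folklore] -/
theorem hw_ofBool_le (b : Bool) : hw (ofBool b : HF α) ≤ 1 := by
  cases b
  · rw [ofBool_false, hw_empty]; exact Nat.zero_le _
  · rw [ofBool_true]; exact hw_ordinal_le 1

/-- The width of a pair. [folklore] -/
theorem hw_pair_le (x y : HF α) : hw (pair x y) ≤ hw x + hw y + 2 := by
  classical
  refine hw_le_of_forall_mem ?_ fun z hz => ?_
  · have : (pair x y).members = {x, y} := by ext z; simp
    rw [this]
    exact (Finset.card_le_two).trans (by omega)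
  · rcases mem_pair.mp hz with rfl | rfl <;> omega

/-- The width of a union: members of members are at most `hw²`, deeper members at most `hw`.
[folklore] -/
theorem hw_sUnion_le (x : HF α) : hw (sUnion x) ≤ hw x * hw x + hw x := by
  refine hw_le_of_forall_mem ?_ fun z hz => ?_
  · have hsub : (sUnion x).members ⊆ x.members.biUnion members := fun z hz => by
      simpa [sUnion] using hz
    refine (Finset.card_le_card hsub).trans ((Finset.card_biUnion_le).trans ?_)
    calc ∑ y ∈ x.members, y.members.card ≤ ∑ _y ∈ x.members, hw x :=
          Finset.sum_le_sum fun y hy => (card_members_le_hw y).trans (hw_le_of_mem (mem_members.mp hy))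
      _ = x.members.card * hw x := by rw [Finset.sum_const, smul_eq_mul]
      _ ≤ hw x * hw x + hw x := by
          have := card_members_le_hw x
          exact (Nat.mul_le_mul_right _ this).trans (Nat.le_add_right _ _)
  · obtain ⟨y, hy, hzy⟩ := mem_sUnion.mp hz
    exact ((hw_le_of_mem hzy).trans (hw_le_of_mem hy)).trans (by nlinarith)

/-- The width of `TheUnique`. [folklore] -/
theorem hw_theUnique_le (x : HF α) : hw (theUnique x) ≤ hw x := by
  classical
  by_cases h : ∃ y, x.members = {y}
  · obtain ⟨y, hy⟩ := h
    rw [theUnique_eq_of_members_eq hy]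
    exact hw_le_of_mem (mem_members.mp (by rw [hy]; simp))
  · rw [theUnique_eq_empty (not_exists.mp h), hw_empty]
    exact Nat.zero_le _

/-- The width of `Card`. [folklore] -/
theorem hw_card_le (x : HF α) : hw (card x) ≤ hw x :=
  (hw_ordinal_le _).trans (card_members_le_hw x)

/-- The width of `Atoms` is at most the number of atoms. [folklore] -/
theorem hw_atoms_le [Fintype α] : hw (atoms : HF α) ≤ Fintype.card α := by
  refine hw_le_of_forall_mem ?_ fun y hy => ?_
  · rw [atoms, members_ofFinset]
    exact Finset.card_image_le.trans (by rw [Finset.card_univ])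
  · obtain ⟨a, rfl⟩ := mem_atoms.mp hy
    simp

/-- The width of a set given by a finset of members. [folklore] -/
theorem hw_ofFinset_le {s : Finset (HF α)} {D : ℕ} (h1 : s.card ≤ D) (h2 : ∀ y ∈ s, hw y ≤ D) :
    hw (ofFinset s) ≤ D :=
  hw_le_of_forall_mem (by rwa [members_ofFinset]) fun y hy => h2 y (mem_ofFinset.mp hy)

end HF

namespace BGS

variable {n : ℕ}

/-! ### Widths of values of terms -/

/-- **The width bound of a term**: a bound on the hereditary width of its value when the
environment, the state and the number of atoms have width at most `Y` (dominates `Y`).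
[Blass–Gurevich–Shelah 1999, §5.2 (proof of Theorem 1: the number of immediate subcomputations
is bounded polynomially)] [folklore] -/
def wB : Term → ℕ → ℕ
  | .var _, Y => Y
  | .empty, Y => Y
  | .atoms, Y => Y
  | .sUnion t, Y => wB t Y * wB t Y + wB t Y
  | .theUnique t, Y => wB t Y
  | .pair s t, Y => wB s Y + wB t Y + 2
  | .card t, Y => wB t Y
  | .mem _ _, Y => Y + 1
  | .eq _ _, Y => Y + 1
  | .cTrue, Y => Y + 1
  | .cFalse, Y => Y + 1
  | .not _, Y => Y + 1
  | .and _ _, Y => Y + 1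
  | .or _ _, Y => Y + 1
  | .edge _ _, Y => Y + 1
  | .dyn _ _, Y => Y
  | .compr _ t r _, Y => wB r Y + wB t (wB r Y)

/-- The width bound dominates its argument. [folklore] -/
theorem le_wB : ∀ (t : Term) (Y : ℕ), Y ≤ wB t Y
  | .var _, _ => le_rfl
  | .empty, _ => le_rfl
  | .atoms, _ => le_rfl
  | .sUnion t, Y => (le_wB t Y).trans (Nat.le_add_left _ _)
  | .theUnique t, Y => le_wB t Y
  | .pair s t, Y => (le_wB s Y).trans (by simp only [wB]; omega)
  | .card t, Y => le_wB t Y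
  | .mem _ _, Y => Nat.le_succ Y
  | .eq _ _, Y => Nat.le_succ Y
  | .cTrue, Y => Nat.le_succ Y
  | .cFalse, Y => Nat.le_succ Y
  | .not _, Y => Nat.le_succ Y
  | .and _ _, Y => Nat.le_succ Y
  | .or _ _, Y => Nat.le_succ Y
  | .edge _ _, Y => Nat.le_succ Y
  | .dyn _ _, _ => le_rfl
  | .compr _ t r _, Y => (le_wB r Y).trans (Nat.le_add_right _ _)

section Widths

variable (G : SimpleGraph (Fin n)) (Sd : DynState n)

/-- The environment has width at most `Y`. [folklore] -/
def EnvBound (Y : ℕ) (σ : Env n) : Prop := ∀ v, (σ v).hw ≤ Y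

/-- The state has width at most `Y`. [folklore] -/
def StBound (Y : ℕ) (Sd : DynState n) : Prop := ∀ f args, (Sd f args).hw ≤ Y

variable {G Sd}

/-- Updating an environment within a larger width. [folklore] -/
theorem EnvBound.update {Y Y' : ℕ} {σ : Env n} (h : EnvBound Y σ) (hY : Y ≤ Y') (v : ℕ) {a : HF (Fin n)}
    (ha : a.hw ≤ Y') : EnvBound Y' (Function.update σ v a) := by
  intro w
  by_cases hw : w = v
  · subst hw; simpa using ha
  · rw [Function.update_of_ne hw]; exact (h w).trans hY

/-- Weakening a state bound. [folklore] -/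
theorem StBound.mono {Y Y' : ℕ} (h : StBound Y Sd) (hY : Y ≤ Y') : StBound Y' Sd :=
  fun f args => (h f args).trans hY

/-- Truth-valued primitives have width `≤ 1`. [folklore] -/
theorem hw_memB_le (x s : Obj n) : (memB x s).hw ≤ 1 := HF.hw_ofBool_le _

/-- See `hw_memB_le`. [folklore] -/
theorem hw_eqB_le (x y : Obj n) : (eqB x y).hw ≤ 1 := HF.hw_ofBool_le _

/-- See `hw_memB_le`. [folklore] -/
theorem hw_edgeB_le (x y : Obj n) : (edgeB G x y).hw ≤ 1 := HF.hw_ofBool_le _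

/-- See `hw_memB_le`. [folklore] -/
theorem hw_bnot_le (x : Obj n) : (HF.bnot x).hw ≤ 1 := HF.hw_ofBool_le _

/-- See `hw_memB_le`. [folklore] -/
theorem hw_band_le (x y : Obj n) : (HF.band x y).hw ≤ 1 := HF.hw_ofBool_le _

/-- See `hw_memB_le`. [folklore] -/
theorem hw_bor_le (x y : Obj n) : (HF.bor x y).hw ≤ 1 := by
  unfold HF.bor; exact HF.hw_ofBool_le _

/-- **The width of the value of a term** is bounded by `wB t Y` when environment, state and the
number of atoms have width at most `Y`. [Blass–Gurevich–Shelah 1999, §5.2 (proof of Thm 1)]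
[folklore] -/
theorem hw_eval_le :
    ∀ (t : Term) (Y : ℕ) (σ : Env n), EnvBound Y σ → StBound Y Sd → n ≤ Y →
      (t.eval G Sd σ).hw ≤ wB t Y
  | .var v, Y, σ, hσ, _, _ => hσ v
  | .empty, Y, σ, _, _, _ => by rw [Term.eval, HF.hw_empty]; exact Nat.zero_le _
  | .atoms, Y, σ, _, _, hn => by
    rw [Term.eval]
    exact (HF.hw_atoms_le).trans (by rwa [Fintype.card_fin])
  | .sUnion t, Y, σ, hσ, hs, hn => by
    rw [Term.eval]
    have := hw_eval_le t Y σ hσ hs hn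
    exact (HF.hw_sUnion_le _).trans (by simp only [wB]; nlinarith)
  | .theUnique t, Y, σ, hσ, hs, hn => by
    rw [Term.eval]
    exact (HF.hw_theUnique_le _).trans (hw_eval_le t Y σ hσ hs hn)
  | .pair s t, Y, σ, hσ, hs, hn => by
    rw [Term.eval]
    have h1 := hw_eval_le s Y σ hσ hs hn
    have h2 := hw_eval_le t Y σ hσ hs hn
    exact (HF.hw_pair_le _ _).trans (by simp only [wB]; omega)
  | .card t, Y, σ, hσ, hs, hn => by
    rw [Term.eval]
    exact (HF.hw_card_le _).trans (hw_eval_le t Y σ hσ hs hn)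
  | .mem s t, Y, σ, _, _, _ => by rw [Term.eval]; exact (hw_memB_le _ _).trans (by simp [wB])
  | .eq s t, Y, σ, _, _, _ => by rw [Term.eval]; exact (hw_eqB_le _ _).trans (by simp [wB])
  | .cTrue, Y, σ, _, _, _ => by rw [Term.eval]; exact (HF.hw_ofBool_le _).trans (by simp [wB])
  | .cFalse, Y, σ, _, _, _ => by rw [Term.eval]; exact (HF.hw_ofBool_le _).trans (by simp [wB])
  | .not t, Y, σ, _, _, _ => by rw [Term.eval]; exact (hw_bnot_le _).trans (by simp [wB])
  | .and s t, Y, σ, _, _, _ => by rw [Term.eval]; exact (hw_band_le _ _).trans (by simp [wB])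
  | .or s t, Y, σ, _, _, _ => by rw [Term.eval]; exact (hw_bor_le _ _).trans (by simp [wB])
  | .edge s t, Y, σ, _, _, _ => by rw [Term.eval]; exact (hw_edgeB_le _ _).trans (by simp [wB])
  | .dyn f args, Y, σ, _, hs, _ => by rw [Term.eval]; exact hs f _
  | .compr v t r g, Y, σ, hσ, hs, hn => by
    classical
    have hr := hw_eval_le r Y σ hσ hs hn
    have hY : Y ≤ wB r Y := le_wB r Y
    rw [Term.eval]
    refine HF.hw_ofFinset_le ?_ fun y hy => ?_
    · refine (Finset.card_image_le.trans ((Finset.card_filter_le _ _).trans ?_)).trans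
        (Nat.le_add_right _ _)
      exact (HF.card_members_le_hw _).trans hr
    · obtain ⟨a, ha, rfl⟩ := Finset.mem_image.mp hy
      have ha' : a ∈ r.eval G Sd σ := HF.mem_members.mp (Finset.mem_filter.mp ha).1
      have haw : a.hw ≤ wB r Y := (HF.hw_le_of_mem ha').trans hr
      exact (hw_eval_le t (wB r Y) _ (hσ.update hY v haw) (hs.mono hY) (hn.trans hY)).trans
        (Nat.le_add_left _ _)

end Widths

/-! ### Widths of active objects -/

/-- **Active objects are narrow**: an object active at a state whose active objects up to that
stage number at most `q` has hereditary width at most `q` (its hereditary members and their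
members are active too). [Blass–Gurevich–Shelah 1999, §5.1] [folklore] -/
theorem hw_le_of_active {P : Program} {G : SimpleGraph (Fin n)} {k q : ℕ}
    (hq : (P.activeSet G k).encard ≤ q) {x : Obj n} (hx : (P.stateAt G k).Active x) : x.hw ≤ q := by
  -- every hereditary member of an active object is active, and so are its members
  have hact : ∀ y, (P.stateAt G k).Active y → ∀ z ∈ y, (P.stateAt G k).Active z := by
    rintro y ⟨c, hc, h⟩ z hz
    rcases h with rfl | h
    · exact ⟨y, hc, Or.inr (HF.mem_tc_of_mem hz)⟩
    · exact ⟨c, hc, Or.inr (HF.mem_tc_of_mem_of_mem_tc h hz)⟩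
  have htc : ∀ z ∈ HF.tc x, (P.stateAt G k).Active z := by
    obtain ⟨c, hc, h⟩ := hx
    intro z hz
    rcases h with rfl | h
    · exact ⟨x, hc, Or.inr hz⟩
    · exact ⟨c, hc, Or.inr (HF.tc_subset_tc_of_mem_tc h hz)⟩
  have hcard : ∀ y, (P.stateAt G k).Active y → y.members.card ≤ q := by
    intro y hy
    have hsub : (↑y.members : Set (Obj n)) ⊆ P.activeSet G k := fun z hz =>
      ⟨k, le_rfl, hact y hy z (HF.mem_members.mp hz)⟩
    have := (Set.encard_le_encard hsub).trans hq
    rw [Set.encard_coe_eq_coe_finsetCard] at this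
    exact_mod_cast this
  exact HF.hw_le_iff.mpr ⟨hcard x hx, fun y hy => hcard y (htc y hy)⟩

/-- Values of dynamic functions are narrow while the census is within `q`. [folklore] -/
theorem stBound_of_encard_le {P : Program} {G : SimpleGraph (Fin n)} {k q : ℕ}
    (hq : (P.activeSet G k).encard ≤ q) : StBound q (P.stateAt G k) := fun f args =>
  hw_le_of_active hq (DynState.Critical.active (Or.inr (Or.inr (Or.inl ⟨f, args, rfl⟩))))

namespace Sim

open Literature.Computability.Complexity (TwoColouring.graph)

/-! ### Closed-form bounds for the code lengths of canonical data -/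

/-- Entries at atom positions are empty (true initially, kept by appending). [folklore] -/
def AtomsNil (n : ℕ) (T : List (List ℕ)) : Prop := ∀ i < n, T.getD i [] = []

/-- The initial table has empty atom entries. [folklore] -/
theorem atomsNil_initTab (n : ℕ) : AtomsNil n (initTab n) := fun i hi => by
  rw [initTab, List.getD_append _ _ _ _ (by simpa using hi)]
  simp [hi]

/-- Table extensions keep atom entries empty. [folklore] -/
theorem AtomsNil.of_extends {T T' : List (List ℕ)} (h : AtomsNil n T) (hT : Canon n T)
    (hx : Extends n T T') : AtomsNil n T' := fun i hi => by
  rw [hx.getD_eq (by have := hT.le_length; omega)]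
  exact h i hi

/-- In a canonical table with empty atom entries, every entry is a list of fewer than `|T|`
indices below `|T|`. [folklore] -/
theorem entry_bounds {T : List (List ℕ)} (hT : Canon n T) (hA : AtomsNil n T) {e : List ℕ} (he : e ∈ T) :
    e.length ≤ T.length ∧ ∀ k ∈ e, k < T.length := by
  obtain ⟨i, hi, rfl⟩ := List.getElem_of_mem he
  have hget : T.getD i [] = T[i] := by
    rw [List.getD_eq_getElem?_getD, List.getElem?_eq_getElem hi, Option.getD_some]
  by_cases hin : i < n
  · rw [← hget, hA i hin]; simp
  · have hni : n ≤ i := Nat.le_of_not_lt hin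
    have hlt : ∀ k ∈ T[i], k < i := fun k hk => hT.wf i hni hi k (by rwa [hget])
    refine ⟨?_, fun k hk => (hlt k hk).trans hi⟩
    have hnd : (T[i]).Nodup := by have := hT.nodup i hni hi; rwa [hget] at this
    have hsub : (T[i]).toFinset ⊆ Finset.range i := fun k hk =>
      Finset.mem_range.mpr (hlt k (List.mem_toFinset.mp hk))
    have := Finset.card_le_card hsub
    rw [List.toFinset_card_of_nodup hnd, Finset.card_range] at this
    exact this.trans hi.le

/-- Code length of an index at most `N`. [folklore] -/
theorem cN_le {k N : ℕ} (h : k ≤ N) : cN k ≤ N :=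
  (Nat.size_le_size h).trans (Nat.size_le.2 Nat.lt_two_pow_self)

/-- Bound on the code of one index below `N`, list overhead included. [folklore] -/
def szB (N : ℕ) : ℕ := 2 * N + 2

/-- Code length of a list of at most `W` indices at most `N`. [folklore] -/
theorem cL_le {l : List ℕ} {N W : ℕ} (hN : ∀ k ∈ l, k ≤ N) (hW : l.length ≤ W) : cL l ≤ W * szB N := by
  unfold cL szB
  calc (l.map fun k => 2 * cN k + 2).sum ≤ (l.map fun _ => 2 * N + 2).sum := by
        apply List.sum_le_sum
        intro k hk
        have := cN_le (hN k hk)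
        omega
    _ = l.length * (2 * N + 2) := by rw [List.map_const', List.sum_replicate, smul_eq_mul]
    _ ≤ W * (2 * N + 2) := Nat.mul_le_mul_right _ hW

/-- Bound on the code of a canonical table with at most `m` entries. [folklore] -/
def tabB (m : ℕ) : ℕ := m * (2 * (m * szB m) + 2)

/-- Code length of a canonical table. [folklore] -/
theorem cT_le {T : List (List ℕ)} (hT : Canon n T) (hA : AtomsNil n T) {m : ℕ} (hm : T.length ≤ m) :
    cT T ≤ tabB m := by
  unfold cT tabB
  calc (T.map fun e => 2 * cL e + 2).sum ≤ (T.map fun _ => 2 * (m * szB m) + 2).sum := by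
        apply List.sum_le_sum
        intro e he
        obtain ⟨hlen, hlt⟩ := entry_bounds hT hA he
        have := cL_le (fun k hk => ((hlt k hk).le.trans hm)) (hlen.trans hm)
        omega
    _ = T.length * (2 * (m * szB m) + 2) := by rw [List.map_const', List.sum_replicate, smul_eq_mul]
    _ ≤ m * (2 * (m * szB m) + 2) := Nat.mul_le_mul_right _ hm

/-- Bound on the code of a canonical table-with-flag. [folklore] -/
def tsB (m : ℕ) : ℕ := cP (tabB m) 1

/-- Code length of a canonical table-with-flag. [folklore] -/
theorem cTS_le {S : TS} (hT : Canon n S.1) (hA : AtomsNil n S.1) {m : ℕ} (hm : S.1.length ≤ m) :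
    cTS S ≤ tsB m := by
  unfold cTS tsB cP
  have := cT_le hT hA hm
  omega

/-- Bound on the comprehension accumulator (table `≤ m`, at most `W` collected indices).
[folklore] -/
def μCB (m W : ℕ) : ℕ := cP (tsB m) (W * szB m)

/-- Bound on the ordinal accumulator. [folklore] -/
def μOB (m W : ℕ) : ℕ := cP (tsB m) (cP (W * szB m) m)

/-- `cP` is monotone. [folklore] -/
theorem cP_le_cP {a a' b b' : ℕ} (ha : a ≤ a') (hb : b ≤ b') : cP a b ≤ cP a' b' := by
  unfold cP; omega

/-! ### Structural counts and guard bounds -/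

mutual
/-- The number of table entries the evaluation of a term may add (width parameter `Y`).
[Blass–Gurevich–Shelah 1999, §5.2 (proof of Thm 1)] [folklore] -/
def cntT : Term → ℕ → ℕ
  | .var _, _ => 0
  | .empty, _ => 0
  | .atoms, _ => 1
  | .sUnion t, Y => cntT t Y + 1
  | .theUnique t, Y => cntT t Y
  | .pair s t, Y => cntT s Y + cntT t Y + 1
  | .card t, Y => cntT t Y + wB t Y + 2
  | .mem s t, Y => cntT s Y + cntT t Y
  | .eq s t, Y => cntT s Y + cntT t Y
  | .cTrue, _ => 0
  | .cFalse, _ => 0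
  | .not t, Y => cntT t Y
  | .and s t, Y => cntT s Y + cntT t Y
  | .or s t, Y => cntT s Y + cntT t Y
  | .edge s t, Y => cntT s Y + cntT t Y
  | .dyn _ args, Y => cntA args Y
  | .compr _ t r g, Y => cntT r Y + wB r Y * (cntT g (wB r Y) + cntT t (wB r Y)) + 1
/-- The number of table entries the evaluation of an argument list may add. [folklore] -/
def cntA : Args → ℕ → ℕ
  | .nil, _ => 0
  | .cons t rest, Y => cntT t Y + cntA rest Y
end

mutual
/-- **The guard bound of a term**: the largest measure a guard inside its evaluation can meet,
from a table of at most `m` entries with width parameter `Y`. [folklore] -/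
def gdT : Term → ℕ → ℕ → ℕ
  | .var _, _, _ => 0
  | .empty, _, _ => 0
  | .atoms, _, _ => 0
  | .sUnion t, Y, m => gdT t Y m
  | .theUnique t, Y, m => gdT t Y m
  | .pair s t, Y, m => gdT s Y m + gdT t Y (m + cntT s Y)
  | .card t, Y, m => gdT t Y m + μOB (m + cntT t Y + wB t Y + 2) (wB t Y)
  | .mem s t, Y, m => gdT s Y m + gdT t Y (m + cntT s Y)
  | .eq s t, Y, m => gdT s Y m + gdT t Y (m + cntT s Y)
  | .cTrue, _, _ => 0
  | .cFalse, _, _ => 0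
  | .not t, Y, m => gdT t Y m
  | .and s t, Y, m => gdT s Y m + gdT t Y (m + cntT s Y)
  | .or s t, Y, m => gdT s Y m + gdT t Y (m + cntT s Y)
  | .edge s t, Y, m => gdT s Y m + gdT t Y (m + cntT s Y)
  | .dyn _ args, Y, m => gdA args Y m
  | .compr _ t r g, Y, m =>
    gdT r Y m + μCB (m + cntT r Y + wB r Y * (cntT g (wB r Y) + cntT t (wB r Y))) (wB r Y) +
      gdT g (wB r Y) (m + cntT r Y + wB r Y * (cntT g (wB r Y) + cntT t (wB r Y))) +
      gdT t (wB r Y) (m + cntT r Y + wB r Y * (cntT g (wB r Y) + cntT t (wB r Y)))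
/-- The guard bound of an argument list. [folklore] -/
def gdA : Args → ℕ → ℕ → ℕ
  | .nil, _, _ => 0
  | .cons t rest, Y, m => gdT t Y m + gdA rest Y (m + cntT t Y)
end

/-! ### No overflow: terms -/

section NoOvfTerms

variable (C : Ctx) (Sd : DynState C.n)

/-- **No overflow at the term `t`**: from a table with its flag down satisfying the invariants
and the width bounds, if the budget dominates the guard bound then the flag is still down after
`ev` and the table grew by at most `cntT`. [folklore] -/
def NoOvfT (t : Term) : Prop :=
  ∀ (ρ : List (ℕ × ℕ)) (S : TS) (Y m : ℕ), S.2 = false → TInv C Sd S.1 → AtomsNil C.n S.1 →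
    EnvValid S.1 ρ → EnvBound Y (envOf C.n S.1 ρ) → StBound Y Sd → C.n ≤ Y → S.1.length ≤ m →
    gdT t Y m ≤ C.B →
    (ev C t ρ S).1.2 = false ∧ (ev C t ρ S).1.1.length ≤ S.1.length + cntT t Y

/-- No overflow at the argument list `a`. [folklore] -/
def NoOvfA (a : Args) : Prop :=
  ∀ (ρ : List (ℕ × ℕ)) (S : TS) (Y m : ℕ), S.2 = false → TInv C Sd S.1 → AtomsNil C.n S.1 →
    EnvValid S.1 ρ → EnvBound Y (envOf C.n S.1 ρ) → StBound Y Sd → C.n ≤ Y → S.1.length ≤ m →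
    gdA a Y m ≤ C.B →
    (evArgs C a ρ S).1.2 = false ∧ (evArgs C a ρ S).1.1.length ≤ S.1.length + cntA a Y

variable {C Sd}

/-- Sequential composition of two evaluations without overflow. [folklore] -/
theorem noOvf_seq {s t : Term} (hs : NoOvfT C Sd s) (ht : NoOvfT C Sd t) {ρ : List (ℕ × ℕ)} {S : TS}
    {Y m : ℕ} (hf : S.2 = false) (hI : TInv C Sd S.1) (hA : AtomsNil C.n S.1) (hρ : EnvValid S.1 ρ)
    (hσ : EnvBound Y (envOf C.n S.1 ρ)) (hSd : StBound Y Sd) (hn : C.n ≤ Y) (hm : S.1.length ≤ m)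
    (hB : gdT s Y m + gdT t Y (m + cntT s Y) ≤ C.B) :
    (ev C t ρ (ev C s ρ S).1).1.2 = false ∧
      (ev C t ρ (ev C s ρ S).1).1.1.length ≤ S.1.length + (cntT s Y + cntT t Y) ∧
      Extends C.n S.1 (ev C t ρ (ev C s ρ S).1).1.1 := by
  obtain ⟨hf1, hl1⟩ := hs ρ S Y m hf hI hA hρ hσ hSd hn hm (le_of_add_le_left hB)
  obtain ⟨hx1, -, -⟩ := ev_sound C Sd s ρ S hf1 hI hρ
  have hσ1 : EnvBound Y (envOf C.n (ev C s ρ S).1.1 ρ) := by rwa [hx1.envOf_eq hρ hI.canon]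
  obtain ⟨hf2, hl2⟩ := ht ρ _ Y (m + cntT s Y) hf1 (hI.of_extends hx1) (hA.of_extends hI.canon hx1)
    (hρ.mono hx1.length_le) hσ1 hSd hn (hl1.trans (Nat.add_le_add_right hm _)) (le_of_add_le_right hB)
  obtain ⟨hx2, -, -⟩ := ev_sound C Sd t ρ _ hf2 (hI.of_extends hx1) (hρ.mono hx1.length_le)
  exact ⟨hf2, hl2.trans (by omega), hx1.trans hx2⟩

/-- No overflow at the leaves. [folklore] -/
theorem noOvfT_var (v : ℕ) : NoOvfT C Sd (.var v) := by
  intro ρ S Y m hf _ _ _ _ _ _ _ _; simpa [ev, cntT] using hf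

/-- See `noOvfT_var`. [folklore] -/
theorem noOvfT_empty : NoOvfT C Sd .empty := by
  intro ρ S Y m hf _ _ _ _ _ _ _ _; simpa [ev, cntT] using hf

/-- See `noOvfT_var`. [folklore] -/
theorem noOvfT_cTrue : NoOvfT C Sd .cTrue := by
  intro ρ S Y m hf _ _ _ _ _ _ _ _; simpa [ev, cntT] using hf

/-- See `noOvfT_var`. [folklore] -/
theorem noOvfT_cFalse : NoOvfT C Sd .cFalse := by
  intro ρ S Y m hf _ _ _ _ _ _ _ _; simpa [ev, cntT] using hf

/-- No overflow at `Atoms`. [folklore] -/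
theorem noOvfT_atoms : NoOvfT C Sd .atoms := by
  intro ρ S Y m hf _ _ _ _ _ _ _ _
  simp only [ev, mk_flag, mk_fst_fst, cntT]
  exact ⟨hf, length_mkSet_le _ _ _⟩

/-- No overflow at the unary clauses adding at most one entry. [folklore] -/
theorem noOvfT_sUnion {t : Term} (ht : NoOvfT C Sd t) : NoOvfT C Sd (.sUnion t) := by
  intro ρ S Y m hf hI hA hρ hσ hSd hn hm hB
  simp only [ev, mk_flag, mk_fst_fst, cntT]
  obtain ⟨hf1, hl1⟩ := ht ρ S Y m hf hI hA hρ hσ hSd hn hm hB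
  exact ⟨hf1, (length_mkSet_le _ _ _).trans (by omega)⟩

/-- See `noOvfT_sUnion`. [folklore] -/
theorem noOvfT_theUnique {t : Term} (ht : NoOvfT C Sd t) : NoOvfT C Sd (.theUnique t) := by
  intro ρ S Y m hf hI hA hρ hσ hSd hn hm hB
  simp only [ev, cntT]
  exact ht ρ S Y m hf hI hA hρ hσ hSd hn hm hB

/-- See `noOvfT_sUnion`. [folklore] -/
theorem noOvfT_not {t : Term} (ht : NoOvfT C Sd t) : NoOvfT C Sd (.not t) := by
  intro ρ S Y m hf hI hA hρ hσ hSd hn hm hB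
  simp only [ev, cntT]
  exact ht ρ S Y m hf hI hA hρ hσ hSd hn hm hB

/-- No overflow at the binary clauses. [folklore] -/
theorem noOvfT_pair {s t : Term} (hs : NoOvfT C Sd s) (ht : NoOvfT C Sd t) : NoOvfT C Sd (.pair s t) := by
  intro ρ S Y m hf hI hA hρ hσ hSd hn hm hB
  simp only [ev, mk_flag, mk_fst_fst, cntT, gdT] at hB ⊢
  obtain ⟨hf2, hl2, -⟩ := noOvf_seq hs ht hf hI hA hρ hσ hSd hn hm hB
  exact ⟨hf2, (length_mkSet_le _ _ _).trans (by omega)⟩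

/-- See `noOvfT_pair`. [folklore] -/
theorem noOvfT_mem {s t : Term} (hs : NoOvfT C Sd s) (ht : NoOvfT C Sd t) : NoOvfT C Sd (.mem s t) := by
  intro ρ S Y m hf hI hA hρ hσ hSd hn hm hB
  simp only [ev, cntT, gdT] at hB ⊢
  obtain ⟨hf2, hl2, -⟩ := noOvf_seq hs ht hf hI hA hρ hσ hSd hn hm hB
  exact ⟨hf2, hl2⟩

/-- See `noOvfT_pair`. [folklore] -/
theorem noOvfT_eq {s t : Term} (hs : NoOvfT C Sd s) (ht : NoOvfT C Sd t) : NoOvfT C Sd (.eq s t) := by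
  intro ρ S Y m hf hI hA hρ hσ hSd hn hm hB
  simp only [ev, cntT, gdT] at hB ⊢
  obtain ⟨hf2, hl2, -⟩ := noOvf_seq hs ht hf hI hA hρ hσ hSd hn hm hB
  exact ⟨hf2, hl2⟩

/-- See `noOvfT_pair`. [folklore] -/
theorem noOvfT_and {s t : Term} (hs : NoOvfT C Sd s) (ht : NoOvfT C Sd t) : NoOvfT C Sd (.and s t) := by
  intro ρ S Y m hf hI hA hρ hσ hSd hn hm hB
  simp only [ev, cntT, gdT] at hB ⊢
  obtain ⟨hf2, hl2, -⟩ := noOvf_seq hs ht hf hI hA hρ hσ hSd hn hm hB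
  exact ⟨hf2, hl2⟩

/-- See `noOvfT_pair`. [folklore] -/
theorem noOvfT_or {s t : Term} (hs : NoOvfT C Sd s) (ht : NoOvfT C Sd t) : NoOvfT C Sd (.or s t) := by
  intro ρ S Y m hf hI hA hρ hσ hSd hn hm hB
  simp only [ev, cntT, gdT] at hB ⊢
  obtain ⟨hf2, hl2, -⟩ := noOvf_seq hs ht hf hI hA hρ hσ hSd hn hm hB
  exact ⟨hf2, hl2⟩

/-- See `noOvfT_pair`. [folklore] -/
theorem noOvfT_edge {s t : Term} (hs : NoOvfT C Sd s) (ht : NoOvfT C Sd t) : NoOvfT C Sd (.edge s t) := by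
  intro ρ S Y m hf hI hA hρ hσ hSd hn hm hB
  simp only [ev, cntT, gdT] at hB ⊢
  obtain ⟨hf2, hl2, -⟩ := noOvf_seq hs ht hf hI hA hρ hσ hSd hn hm hB
  exact ⟨hf2, hl2⟩

/-- No overflow at a dynamic function symbol. [folklore] -/
theorem noOvfT_dyn {f : ℕ} {args : Args} (ha : NoOvfA C Sd args) : NoOvfT C Sd (.dyn f args) := by
  intro ρ S Y m hf hI hA hρ hσ hSd hn hm hB
  simp only [ev, cntT, gdT] at hB ⊢
  exact ha ρ S Y m hf hI hA hρ hσ hSd hn hm hB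

/-! #### `Card`: the ordinal loop stays within budget -/

/-- **The guarded ordinal loop does not overflow** when the budget dominates `μOB`: from the
invariant after `j` rounds, on a table of at most `m₁ + 1 + j` entries with empty atom entries,
folding `l` more rounds with `j + |l| ≤ K` keeps the flag down and adds at most `|l|` entries.
[folklore] -/
theorem noOvf_ordFold {B m₁ K : ℕ} (hB : μOB (m₁ + K + 2) K ≤ B) :
    ∀ (l : List ℕ) (acc : TS × (List ℕ × ℕ)) (j : ℕ), OrdInv n acc j → AtomsNil n acc.1.1 →
      acc.1.1.length ≤ m₁ + 1 + j → acc.2.1.length = j → j + l.length ≤ K →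
      (foldCap μO B (fun _ acc => ordStep n acc) acc l).1.2 = false ∧
        (foldCap μO B (fun _ acc => ordStep n acc) acc l).1.1.length ≤ acc.1.1.length + l.length
  | [], acc, j, hinv, _, _, _, _ => by simpa using hinv.flag
  | a :: l, acc, j, hinv, hA, hlen, hords, hK => by
    have hN : acc.1.1.length ≤ m₁ + K + 2 := by simp only [List.length_cons] at hK; omega
    -- the guard is silent
    have hμ : μO acc ≤ B := by
      refine le_trans ?_ hB
      unfold μO μOB
      refine cP_le_cP (cTS_le hinv.canon hA hN) (cP_le_cP ?_ ?_)
      · refine cL_le (fun k hk => ((hinv.ords_lt k hk).le.trans hN)) ?_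
        rw [hords]; simp only [List.length_cons] at hK; omega
      · exact cN_le (hinv.cur_lt.le.trans hN)
    rw [foldCap_cons, hinv.flag, Bool.false_or, if_neg (by simpa using hμ)]
    obtain ⟨hinv', hx⟩ := ordInv_ordStep hinv
    have hlen' : (ordStep n acc).1.1.length ≤ m₁ + 1 + (j + 1) :=
      (length_mkSet_le _ _ _).trans (by omega)
    have hords' : (ordStep n acc).2.1.length = j + 1 := by
      show (acc.2.1 ++ [acc.2.2]).length = j + 1
      simp [hords]
    obtain ⟨hf, hl⟩ := noOvf_ordFold hB l (ordStep n acc) (j + 1) hinv' (hA.of_extends hinv.canon hx)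
      hlen' hords' (by simp only [List.length_cons] at hK; omega)
    refine ⟨hf, hl.trans ?_⟩
    have := length_mkSet_le n acc.1.1 (acc.2.1 ++ [acc.2.2])
    show (Sim.mkSet n acc.1.1 (acc.2.1 ++ [acc.2.2])).1.length + l.length ≤ acc.1.1.length + (l.length + 1)
    omega

/-- **`mkOrd` does not overflow** on a driving list of length at most `K` when the budget
dominates `μOB (m₁ + K + 2) K`, `m₁` bounding the table. [folklore] -/
theorem noOvf_mkOrd {B m₁ K : ℕ} {S : TS} (hf : S.2 = false) (hT : Canon n S.1) (hA : AtomsNil n S.1)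
    (hm : S.1.length ≤ m₁) {l : List ℕ} (hl : l.length ≤ K) (hB : μOB (m₁ + K + 2) K ≤ B) :
    (mkOrd B n S l).1.2 = false ∧ (mkOrd B n S l).1.1.length ≤ S.1.length + K + 2 := by
  have h0 : OrdInv n ((mk n S []).1, ([], (mk n S []).2)) 0 := by
    refine ⟨hf, hT.canon_mkSet (by simp), snd_mkSet_lt _ _ _, by simp, ?_, ?_⟩
    · show val n (Sim.mkSet n S.1 []).1 (Sim.mkSet n S.1 []).2 = HF.ordinal 0
      rw [hT.val_mkSet (by simp), List.map_nil, HF.ordinal_zero]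
      exact HF.eq_empty_of_forall_not_mem (HF.not_isAtom_ofList _) fun x hx => by simp at hx
    · intro x; simp
  have hx0 : Extends n S.1 (mk n S []).1.1 := Extends.mkSet hT (by simp)
  obtain ⟨hf', hl'⟩ := noOvf_ordFold hB l _ 0 h0 (hA.of_extends hT hx0)
    ((length_mkSet_le _ _ _).trans (by omega)) rfl (by simpa using hl)
  unfold mkOrd
  refine ⟨hf', hl'.trans ?_⟩
  have := length_mkSet_le n S.1 []
  simp only [mk_fst_fst] at this ⊢
  omega

/-- No overflow at `Card t`. [folklore] -/
theorem noOvfT_card {t : Term} (ht : NoOvfT C Sd t) : NoOvfT C Sd (.card t) := by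
  intro ρ S Y m hf hI hA hρ hσ hSd hn hm hB
  simp only [ev, cntT, gdT] at hB ⊢
  obtain ⟨hf1, hl1⟩ := ht ρ S Y m hf hI hA hρ hσ hSd hn hm (le_of_add_le_left hB)
  obtain ⟨hx1, hi1, hv1⟩ := ev_sound C Sd t ρ S hf1 hI hρ
  -- the driving list has at most `wB t Y` members
  have hK : (elems C.n (ev C t ρ S).1.1 (ev C t ρ S).2).length ≤ wB t Y := by
    rw [← hx1.canon.card_members_val hi1, hv1]
    exact (HF.card_members_le_hw _).trans (hw_eval_le t Y _ hσ hSd hn)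
  obtain ⟨hf2, hl2⟩ := noOvf_mkOrd (B := C.B) hf1 hx1.canon (hA.of_extends hI.canon hx1)
    (hl1.trans (Nat.add_le_add_right hm _)) hK (le_of_add_le_right hB)
  exact ⟨hf2, hl2.trans (by omega)⟩

/-! #### Comprehension: the loop over the range stays within budget -/

/-- **The guarded comprehension loop does not overflow.** With `Y' = wB r Y` bounding the range,
`m'` bounding every intermediate table, and the budget dominating `μCB m' Y'` and the guard
bounds of guard and head at `(Y', m')`: from the loop invariant after the members `done`, folding
the remaining members `l` keeps the flag down and adds at most `|l| · (cntT g Y' + cntT t Y')`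
entries. [Blass–Gurevich–Shelah 1999, §5.2 (proof of Thm 1)] [folklore] -/
theorem noOvf_comprFold {v : ℕ} {t g : Term} (ht : NoOvfT C Sd t) (hg : NoOvfT C Sd g)
    (hts : SoundT C Sd t) (hgs : SoundT C Sd g) {ρ : List (ℕ × ℕ)} {T₀ : List (List ℕ)}
    (hI : TInv C Sd T₀) (hρ : EnvValid T₀ ρ) {Y Y' m' : ℕ} (hYY' : Y ≤ Y')
    (hσ : EnvBound Y (envOf C.n T₀ ρ)) (hSd : StBound Y Sd) (hn : C.n ≤ Y)
    (hB : μCB m' Y' + gdT g Y' m' + gdT t Y' m' ≤ C.B) (L : ℕ) (hL : L ≤ Y')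
    (hm' : T₀.length + L * (cntT g Y' + cntT t Y') ≤ m') :
    ∀ (l : List ℕ) (acc : TS × List ℕ) (done : List ℕ),
      ComprInv C Sd v t g (envOf C.n T₀ ρ) T₀ acc done → acc.1.2 = false → AtomsNil C.n acc.1.1 →
      (∀ a ∈ l, a < T₀.length ∧ (val C.n T₀ a).hw ≤ Y') →
      acc.1.1.length ≤ T₀.length + done.length * (cntT g Y' + cntT t Y') →
      acc.2.length ≤ done.length → done.length + l.length ≤ L →
      (foldCap μC C.B (comprStep C v t g ρ) acc l).1.2 = false ∧
        (foldCap μC C.B (comprStep C v t g ρ) acc l).1.1.length ≤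
          acc.1.1.length + l.length * (cntT g Y' + cntT t Y')
  | [], acc, done, _, hf, _, _, _, _, _ => by simpa using hf
  | a :: l, acc, done, hinv, hf, hA, hal, hlen, hout, hdl => by
    simp only [List.length_cons] at hdl
    have hj : done.length + 1 ≤ L := by omega
    have hN : acc.1.1.length ≤ m' := by
      refine hlen.trans (le_trans ?_ hm')
      exact Nat.add_le_add_left (Nat.mul_le_mul_right _ (by omega)) _
    -- the guard is silent
    have hμ : μC acc ≤ C.B := by
      refine le_trans ?_ (le_of_add_le_left (le_of_add_le_left hB))
      unfold μC μCB
      refine cP_le_cP (cTS_le hinv.ext.canon hA hN) ?_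
      exact cL_le (fun k hk => (hinv.out_lt k hk).le.trans hN) (hout.trans (by omega))
    rw [foldCap_cons, hf, Bool.false_or, if_neg (by simpa using hμ)]
    -- the round runs: guard, then possibly head
    obtain ⟨haT, haw⟩ := hal a (by simp)
    have hIa : TInv C Sd acc.1.1 := hI.of_extends hinv.ext
    have hρa : EnvValid acc.1.1 ((v, a) :: ρ) :=
      (hρ.mono hinv.ext.length_le).cons (haT.trans_le hinv.ext.length_le)
    have henv : envOf C.n acc.1.1 ((v, a) :: ρ) = Function.update (envOf C.n T₀ ρ) v (val C.n T₀ a) := by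
      rw [envOf_cons, hinv.ext.envOf_eq hρ hI.canon, hinv.ext.val_eq haT]
    have hσa : EnvBound Y' (envOf C.n acc.1.1 ((v, a) :: ρ)) := by
      rw [henv]; exact hσ.update hYY' v haw
    obtain ⟨hfg, hlg⟩ := hg _ _ Y' m' hf hIa hA hρa hσa (hSd.mono hYY') (hn.trans hYY') hN
      (le_of_add_le_right (le_of_add_le_left hB))
    obtain ⟨hxg, -, -⟩ := hgs _ _ hfg hIa hρa
    have hcmul : (done.length + 1) * (cntT g Y' + cntT t Y') ≤ L * (cntT g Y' + cntT t Y') :=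
      Nat.mul_le_mul_right _ hj
    have hstep : (comprStep C v t g ρ a acc).1.2 = false ∧
        (comprStep C v t g ρ a acc).1.1.length ≤ acc.1.1.length + (cntT g Y' + cntT t Y') ∧
        Extends C.n acc.1.1 (comprStep C v t g ρ a acc).1.1 ∧
        (comprStep C v t g ρ a acc).2.length ≤ (done ++ [a]).length := by
      by_cases hb : isTrueIdx C.n (ev C g ((v, a) :: ρ) acc.1).2 = true
      · rw [comprStep_of_pos C v t g ρ a acc hb]
        have hNg : (ev C g ((v, a) :: ρ) acc.1).1.1.length ≤ m' := by
          refine (hlg.trans (Nat.add_le_add_right hlen _)).trans (le_trans ?_ hm')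
          rw [Nat.succ_mul] at hcmul
          omega
        have hσg : EnvBound Y' (envOf C.n (ev C g ((v, a) :: ρ) acc.1).1.1 ((v, a) :: ρ)) := by
          rwa [hxg.envOf_eq hρa hIa.canon]
        obtain ⟨hft, hlt⟩ := ht _ _ Y' m' hfg (hIa.of_extends hxg) (hA.of_extends hIa.canon hxg)
          (hρa.mono hxg.length_le) hσg (hSd.mono hYY') (hn.trans hYY') hNg (le_of_add_le_right hB)
        obtain ⟨hxt, -, -⟩ := hts _ _ hft (hIa.of_extends hxg) (hρa.mono hxg.length_le)
        exact ⟨hft, hlt.trans (by omega), hxg.trans hxt, by simp; omega⟩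
      · rw [comprStep_of_neg C v t g ρ a acc hb]
        exact ⟨hfg, hlg.trans (by omega), hxg, by simp; omega⟩
    obtain ⟨hf1, hl1, hx1, hout'⟩ := hstep
    have hinv' := comprInv_step hts hgs hI hρ hinv haT hf1
    have hsm : (done ++ [a]).length * (cntT g Y' + cntT t Y') =
        done.length * (cntT g Y' + cntT t Y') + (cntT g Y' + cntT t Y') := by
      simp only [List.length_append, List.length_singleton, Nat.succ_mul]
    obtain ⟨hf2, hl2⟩ := noOvf_comprFold ht hg hts hgs hI hρ hYY' hσ hSd hn hB L hL hm' l _ (done ++ [a])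
      hinv' hf1 (hA.of_extends hIa.canon hx1) (fun x hx => hal x (by simp [hx]))
      (by rw [hsm]; omega) hout'
      (by simp only [List.length_append, List.length_singleton]; omega)
    refine ⟨hf2, hl2.trans ?_⟩
    have hcm : (a :: l).length * (cntT g Y' + cntT t Y') =
        l.length * (cntT g Y' + cntT t Y') + (cntT g Y' + cntT t Y') := by
      rw [List.length_cons, Nat.succ_mul]
    rw [hcm]
    omega

/-- No overflow at a comprehension term. [Blass–Gurevich–Shelah 1999, §5.2 (proof of Thm 1)]
[folklore] -/
theorem noOvfT_compr {v : ℕ} {t r g : Term} (ht : NoOvfT C Sd t) (hr : NoOvfT C Sd r)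
    (hg : NoOvfT C Sd g) : NoOvfT C Sd (.compr v t r g) := by
  intro ρ S Y m hf hI hA hρ hσ hSd hn hm hB
  rw [ev_compr]
  simp only [mk_flag, mk_fst_fst, cntT, gdT] at hB ⊢
  have hBr : gdT r Y m ≤ C.B := by omega
  have hB' : μCB (m + cntT r Y + wB r Y * (cntT g (wB r Y) + cntT t (wB r Y))) (wB r Y) +
      gdT g (wB r Y) (m + cntT r Y + wB r Y * (cntT g (wB r Y) + cntT t (wB r Y))) +
      gdT t (wB r Y) (m + cntT r Y + wB r Y * (cntT g (wB r Y) + cntT t (wB r Y))) ≤ C.B := by omega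
  obtain ⟨hf1, hl1⟩ := hr ρ S Y m hf hI hA hρ hσ hSd hn hm hBr
  obtain ⟨hxr, hir, hvr⟩ := ev_sound C Sd r ρ S hf1 hI hρ
  have hIr : TInv C Sd (ev C r ρ S).1.1 := hI.of_extends hxr
  have hρr : EnvValid (ev C r ρ S).1.1 ρ := hρ.mono hxr.length_le
  have hσr : EnvBound Y (envOf C.n (ev C r ρ S).1.1 ρ) := by rwa [hxr.envOf_eq hρ hI.canon]
  have hYY' : Y ≤ wB r Y := le_wB r Y
  -- the range is narrow
  have hwr : (val C.n (ev C r ρ S).1.1 (ev C r ρ S).2).hw ≤ wB r Y := by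
    rw [hvr]; exact hw_eval_le r Y _ hσ hSd hn
  have hL : (elems C.n (ev C r ρ S).1.1 (ev C r ρ S).2).length ≤ wB r Y := by
    rw [← hxr.canon.card_members_val hir]
    exact (HF.card_members_le_hw _).trans hwr
  have hal : ∀ a ∈ elems C.n (ev C r ρ S).1.1 (ev C r ρ S).2,
      a < (ev C r ρ S).1.1.length ∧ (val C.n (ev C r ρ S).1.1 a).hw ≤ wB r Y := fun a ha =>
    ⟨(hxr.canon.lt_of_mem_elems hir ha).trans hir,
      (HF.hw_le_of_mem ((hxr.canon.mem_elems_iff hir a).mp ha).2).trans hwr⟩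
  have h0 : ComprInv C Sd v t g (envOf C.n (ev C r ρ S).1.1 ρ) (ev C r ρ S).1.1 ((ev C r ρ S).1, []) [] :=
    ⟨Extends.refl hxr.canon, by simp, fun x => by simp⟩
  have hml := Nat.mul_le_mul_right (cntT g (wB r Y) + cntT t (wB r Y)) hL
  obtain ⟨hf2, hl2⟩ := noOvf_comprFold ht hg (ev_sound C Sd t) (ev_sound C Sd g) hIr hρr hYY' hσr hSd hn
    hB' _ hL (by omega) _ ((ev C r ρ S).1, []) [] h0 hf1 (hA.of_extends hI.canon hxr) hal
    (by simp) (by simp) (by simp)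
  refine ⟨hf2, (length_mkSet_le _ _ _).trans ?_⟩
  dsimp only at hl2
  omega

/-- No overflow at argument lists. [folklore] -/
theorem noOvfA_nil : NoOvfA C Sd .nil := by
  intro ρ S Y m hf _ _ _ _ _ _ _ _; simpa [evArgs, cntA] using hf

/-- See `noOvfA_nil`. [folklore] -/
theorem noOvfA_cons {t : Term} {rest : Args} (ht : NoOvfT C Sd t) (hr : NoOvfA C Sd rest) :
    NoOvfA C Sd (.cons t rest) := by
  intro ρ S Y m hf hI hA hρ hσ hSd hn hm hB
  simp only [evArgs, cntA, gdA] at hB ⊢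
  obtain ⟨hf1, hl1⟩ := ht ρ S Y m hf hI hA hρ hσ hSd hn hm (le_of_add_le_left hB)
  obtain ⟨hx1, -, -⟩ := ev_sound C Sd t ρ S hf1 hI hρ
  have hσ1 : EnvBound Y (envOf C.n (ev C t ρ S).1.1 ρ) := by rwa [hx1.envOf_eq hρ hI.canon]
  obtain ⟨hf2, hl2⟩ := hr ρ _ Y (m + cntT t Y) hf1 (hI.of_extends hx1) (hA.of_extends hI.canon hx1)
    (hρ.mono hx1.length_le) hσ1 hSd hn (hl1.trans (Nat.add_le_add_right hm _)) (le_of_add_le_right hB)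
  exact ⟨hf2, hl2.trans (by omega)⟩

variable (C Sd)

mutual
/-- **No overflow in the evaluator** (all terms). [Blass–Gurevich–Shelah 1999, §5.2 (proof of
Theorem 1)] [folklore] -/
theorem noOvf_ev : ∀ t : Term, NoOvfT C Sd t
  | .var v => noOvfT_var v
  | .empty => noOvfT_empty
  | .atoms => noOvfT_atoms
  | .sUnion t => noOvfT_sUnion (noOvf_ev t)
  | .theUnique t => noOvfT_theUnique (noOvf_ev t)
  | .pair s t => noOvfT_pair (noOvf_ev s) (noOvf_ev t)
  | .card t => noOvfT_card (noOvf_ev t)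
  | .mem s t => noOvfT_mem (noOvf_ev s) (noOvf_ev t)
  | .eq s t => noOvfT_eq (noOvf_ev s) (noOvf_ev t)
  | .cTrue => noOvfT_cTrue
  | .cFalse => noOvfT_cFalse
  | .not t => noOvfT_not (noOvf_ev t)
  | .and s t => noOvfT_and (noOvf_ev s) (noOvf_ev t)
  | .or s t => noOvfT_or (noOvf_ev s) (noOvf_ev t)
  | .edge s t => noOvfT_edge (noOvf_ev s) (noOvf_ev t)
  | .dyn _ args => noOvfT_dyn (noOvf_evArgs args)
  | .compr _ t r g => noOvfT_compr (noOvf_ev t) (noOvf_ev r) (noOvf_ev g)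
/-- No overflow in the evaluator on argument lists. [folklore] -/
theorem noOvf_evArgs : ∀ a : Args, NoOvfA C Sd a
  | .nil => noOvfA_nil
  | .cons t rest => noOvfA_cons (noOvf_ev t) (noOvf_evArgs rest)
end

end NoOvfTerms

/-! ### No overflow: rules -/

/-- The length of an argument list. [folklore] -/
def argsLen : Args → ℕ
  | .nil => 0
  | .cons _ rest => argsLen rest + 1

/-- `evArgs` returns one index per argument. [folklore] -/
theorem length_evArgs (C : Ctx) : ∀ (a : Args) (ρ : List (ℕ × ℕ)) (S : TS),
    (evArgs C a ρ S).2.length = argsLen a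
  | .nil, _, _ => rfl
  | .cons t rest, ρ, S => by
    simp only [evArgs, List.length_cons, argsLen, length_evArgs C rest]

/-- The largest dynamic symbol updated by a rule. [folklore] -/
def symB : Rule → ℕ
  | .skip => 0
  | .update f _ _ => f
  | .cond _ R₁ R₂ => max (symB R₁) (symB R₂)
  | .forallDo _ _ R => symB R

/-- The largest arity of an update in a rule. [folklore] -/
def arB : Rule → ℕ
  | .skip => 0
  | .update _ args _ => argsLen args
  | .cond _ R₁ R₂ => max (arB R₁) (arB R₂)
  | .forallDo _ _ R => arB R

/-- Concatenation inside a guarded fold preserves a property of the collected items. [folklore] -/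
theorem foldCap_forall_snd {α β : Type} (μ : TS × List β → ℕ) (B : ℕ) (step : α → TS × List β → TS × List β)
    (P : β → Prop) (hstep : ∀ a acc, (∀ c ∈ acc.2, P c) → ∀ c ∈ (step a acc).2, P c) :
    ∀ (l : List α) (acc : TS × List β), (∀ c ∈ acc.2, P c) → ∀ c ∈ (foldCap μ B step acc l).2, P c
  | [], acc, h => by simpa using h
  | a :: l, acc, h => by
    rw [foldCap_cons]
    split
    · exact foldCap_forall_snd μ B step P hstep l _ h
    · exact foldCap_forall_snd μ B step P hstep l _ (hstep a acc h)

/-- **Coded updates carry the symbols and arities of the rule** (unconditionally). [folklore] -/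
theorem den_syntactic (C : Ctx) : ∀ (R : Rule) (ρ : List (ℕ × ℕ)) (S : TS),
    ∀ c ∈ (den C R ρ S).2, c.1.1 ≤ symB R ∧ c.1.2.length ≤ arB R
  | .skip, _, _, c, hc => by simp [den] at hc
  | .update f args t, ρ, S, c, hc => by
    simp only [den, List.mem_singleton] at hc
    subst hc
    exact ⟨le_rfl, by rw [length_evArgs]; rfl⟩
  | .cond g R₁ R₂, ρ, S, c, hc => by
    simp only [den] at hc
    split at hc
    · obtain ⟨h1, h2⟩ := den_syntactic C R₁ ρ _ c hc
      exact ⟨h1.trans (le_max_left _ _), h2.trans (le_max_left _ _)⟩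
    · obtain ⟨h1, h2⟩ := den_syntactic C R₂ ρ _ c hc
      exact ⟨h1.trans (le_max_right _ _), h2.trans (le_max_right _ _)⟩
  | .forallDo v r R, ρ, S, c, hc => by
    rw [den_forallDo] at hc
    exact foldCap_forall_snd μU C.B (forallStep C v R ρ) (fun c => c.1.1 ≤ symB R ∧ c.1.2.length ≤ arB R)
      (fun a acc h c hc => by
        simp only [forallStep, List.mem_append] at hc
        exact hc.elim (h c) (den_syntactic C R _ _ c)) _ _ (by simp) c hc

/-- Bound on the code of one update (symbol `≤ F`, arity `≤ A`, indices `≤ N`). [folklore] -/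
def uB (F A N : ℕ) : ℕ := cP (cP F (A * szB N)) N

/-- Code length of a coded update. [folklore] -/
theorem cU_le {c : CUpdate} {F A N : ℕ} (hf : c.1.1 ≤ F) (ha : c.1.2.length ≤ A)
    (hi : ∀ k ∈ c.1.2, k ≤ N) (hv : c.2 ≤ N) : cU c ≤ uB F A N := by
  unfold cU uB
  exact cP_le_cP (cP_le_cP (cN_le hf) (cL_le hi ha)) (cN_le hv)

/-- Code length of a list of at most `U` coded updates each of code length at most `ub`.
[folklore] -/
theorem cUL_le {ups : List CUpdate} {U ub : ℕ} (hub : ∀ c ∈ ups, cU c ≤ ub) (hU : ups.length ≤ U) :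
    cUL ups ≤ U * (2 * ub + 2) := by
  unfold cUL
  calc (ups.map fun u => 2 * cU u + 2).sum ≤ (ups.map fun _ => 2 * ub + 2).sum := by
        apply List.sum_le_sum; intro c hc; have := hub c hc; omega
    _ = ups.length * (2 * ub + 2) := by rw [List.map_const', List.sum_replicate, smul_eq_mul]
    _ ≤ U * (2 * ub + 2) := Nat.mul_le_mul_right _ hU

/-- Bound on the `do forall` accumulator. [folklore] -/
def μUB (m U ub : ℕ) : ℕ := cP (tsB m) (U * (2 * ub + 2))

/-- The number of updates a rule may produce. [folklore] -/
def ucnt : Rule → ℕ → ℕ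
  | .skip, _ => 0
  | .update _ _ _, _ => 1
  | .cond _ R₁ R₂, Y => ucnt R₁ Y + ucnt R₂ Y
  | .forallDo _ r R, Y => wB r Y * ucnt R (wB r Y)

/-- The number of table entries a rule may add. [folklore] -/
def cntR : Rule → ℕ → ℕ
  | .skip, _ => 0
  | .update _ args t, Y => cntA args Y + cntT t Y
  | .cond g R₁ R₂, Y => cntT g Y + cntR R₁ Y + cntR R₂ Y
  | .forallDo _ r R, Y => cntT r Y + wB r Y * cntR R (wB r Y)

/-- **The guard bound of a rule.** [folklore] -/
def gdR : Rule → ℕ → ℕ → ℕ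
  | .skip, _, _ => 0
  | .update _ args t, Y, m => gdA args Y m + gdT t Y (m + cntA args Y)
  | .cond g R₁ R₂, Y, m => gdT g Y m + gdR R₁ Y (m + cntT g Y) + gdR R₂ Y (m + cntT g Y)
  | .forallDo _ r R, Y, m =>
    gdT r Y m + μUB (m + cntT r Y + wB r Y * cntR R (wB r Y)) (wB r Y * ucnt R (wB r Y))
      (uB (symB R) (arB R) (m + cntT r Y + wB r Y * cntR R (wB r Y))) +
      gdR R (wB r Y) (m + cntT r Y + wB r Y * cntR R (wB r Y))

section NoOvfRules

variable (C : Ctx) (Sd : DynState C.n)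

/-- **No overflow at the rule `R`**: flag stays down, the table grows by at most `cntR`, and at
most `ucnt` updates are produced. [folklore] -/
def NoOvfR (R : Rule) : Prop :=
  ∀ (ρ : List (ℕ × ℕ)) (S : TS) (Y m : ℕ), S.2 = false → TInv C Sd S.1 → AtomsNil C.n S.1 →
    EnvValid S.1 ρ → EnvBound Y (envOf C.n S.1 ρ) → StBound Y Sd → C.n ≤ Y → S.1.length ≤ m →
    gdR R Y m ≤ C.B →
    (den C R ρ S).1.2 = false ∧ (den C R ρ S).1.1.length ≤ S.1.length + cntR R Y ∧
      (den C R ρ S).2.length ≤ ucnt R Y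

variable {C Sd}

/-- No overflow at `Skip`. [folklore] -/
theorem noOvfR_skip : NoOvfR C Sd .skip := by
  intro ρ S Y m hf _ _ _ _ _ _ _ _; simpa [den, cntR, ucnt] using hf

/-- No overflow at an update rule. [folklore] -/
theorem noOvfR_update (f : ℕ) (args : Args) (t : Term) : NoOvfR C Sd (.update f args t) := by
  intro ρ S Y m hf hI hA hρ hσ hSd hn hm hB
  simp only [den, cntR, ucnt, gdR, List.length_singleton] at hB ⊢
  obtain ⟨hf1, hl1⟩ := noOvf_evArgs C Sd args ρ S Y m hf hI hA hρ hσ hSd hn hm (le_of_add_le_left hB)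
  obtain ⟨hx1, -, -⟩ := evArgs_sound C Sd args ρ S hf1 hI hρ
  have hσ1 : EnvBound Y (envOf C.n (evArgs C args ρ S).1.1 ρ) := by rwa [hx1.envOf_eq hρ hI.canon]
  obtain ⟨hf2, hl2⟩ := noOvf_ev C Sd t ρ _ Y (m + cntA args Y) hf1 (hI.of_extends hx1)
    (hA.of_extends hI.canon hx1) (hρ.mono hx1.length_le) hσ1 hSd hn
    (hl1.trans (Nat.add_le_add_right hm _)) (le_of_add_le_right hB)
  exact ⟨hf2, hl2.trans (by omega), le_rfl⟩

/-- No overflow at a conditional rule. [folklore] -/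
theorem noOvfR_cond {g : Term} {R₁ R₂ : Rule} (h₁ : NoOvfR C Sd R₁) (h₂ : NoOvfR C Sd R₂) :
    NoOvfR C Sd (.cond g R₁ R₂) := by
  intro ρ S Y m hf hI hA hρ hσ hSd hn hm hB
  simp only [den, cntR, ucnt, gdR] at hB ⊢
  obtain ⟨hf1, hl1⟩ := noOvf_ev C Sd g ρ S Y m hf hI hA hρ hσ hSd hn hm (by omega)
  obtain ⟨hx1, -, -⟩ := ev_sound C Sd g ρ S hf1 hI hρ
  have hσ1 : EnvBound Y (envOf C.n (ev C g ρ S).1.1 ρ) := by rwa [hx1.envOf_eq hρ hI.canon]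
  have hm1 : (ev C g ρ S).1.1.length ≤ m + cntT g Y := hl1.trans (Nat.add_le_add_right hm _)
  split
  · obtain ⟨hf2, hl2, hu2⟩ := h₁ ρ _ Y _ hf1 (hI.of_extends hx1) (hA.of_extends hI.canon hx1)
      (hρ.mono hx1.length_le) hσ1 hSd hn hm1 (by omega)
    exact ⟨hf2, hl2.trans (by omega), hu2.trans (Nat.le_add_right _ _)⟩
  · obtain ⟨hf2, hl2, hu2⟩ := h₂ ρ _ Y _ hf1 (hI.of_extends hx1) (hA.of_extends hI.canon hx1)
      (hρ.mono hx1.length_le) hσ1 hSd hn hm1 (by omega)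
    exact ⟨hf2, hl2.trans (by omega), hu2.trans (Nat.le_add_left _ _)⟩

/-- **The guarded `do forall` loop does not overflow.** [Blass–Gurevich–Shelah 1999, §5.2 (proof
of Thm 1: "the bound r … in a do-forall rule ensures that the number of immediate subcomputations is
bounded")] [folklore] -/
theorem noOvf_forallFold {v : ℕ} {R : Rule} (hR : NoOvfR C Sd R) (hRs : SoundR C Sd R)
    {ρ : List (ℕ × ℕ)} {T₀ : List (List ℕ)} (hI : TInv C Sd T₀) (hρ : EnvValid T₀ ρ) {Y Y' m' : ℕ}
    (hYY' : Y ≤ Y') (hσ : EnvBound Y (envOf C.n T₀ ρ)) (hSd : StBound Y Sd) (hn : C.n ≤ Y)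
    (hB : μUB m' (Y' * ucnt R Y') (uB (symB R) (arB R) m') + gdR R Y' m' ≤ C.B) (L : ℕ) (hL : L ≤ Y')
    (hm' : T₀.length + L * cntR R Y' ≤ m') :
    ∀ (l : List ℕ) (acc : TS × List CUpdate) (done : List ℕ),
      ForallInv C Sd v R (envOf C.n T₀ ρ) T₀ acc done → acc.1.2 = false → AtomsNil C.n acc.1.1 →
      (∀ a ∈ l, a < T₀.length ∧ (val C.n T₀ a).hw ≤ Y') →
      acc.1.1.length ≤ T₀.length + done.length * cntR R Y' →
      acc.2.length ≤ done.length * ucnt R Y' → (∀ c ∈ acc.2, c.1.1 ≤ symB R ∧ c.1.2.length ≤ arB R) →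
      done.length + l.length ≤ L →
      (foldCap μU C.B (forallStep C v R ρ) acc l).1.2 = false ∧
        (foldCap μU C.B (forallStep C v R ρ) acc l).1.1.length ≤ acc.1.1.length + l.length * cntR R Y' ∧
        (foldCap μU C.B (forallStep C v R ρ) acc l).2.length ≤ acc.2.length + l.length * ucnt R Y'
  | [], acc, done, _, hf, _, _, _, _, _, _ => by simpa using hf
  | a :: l, acc, done, hinv, hf, hA, hal, hlen, hups, hsyn, hdl => by
    simp only [List.length_cons] at hdl
    have hj : done.length + 1 ≤ L := by omega
    have hcm : (done.length + 1) * cntR R Y' ≤ L * cntR R Y' := Nat.mul_le_mul_right _ hj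
    have hum : (done.length + 1) * ucnt R Y' ≤ Y' * ucnt R Y' := Nat.mul_le_mul_right _ (hj.trans hL)
    have hN : acc.1.1.length ≤ m' := by rw [Nat.succ_mul] at hcm; omega
    -- the guard is silent
    have hμ : μU acc ≤ C.B := by
      refine le_trans ?_ (le_of_add_le_left hB)
      unfold μU μUB
      refine cP_le_cP (cTS_le hinv.ext.canon hA hN) (cUL_le (fun c hc => ?_) ?_)
      · obtain ⟨h1, h2⟩ := hsyn c hc
        obtain ⟨hv, hi⟩ := hinv.valid c hc
        exact cU_le h1 h2 (fun k hk => ((hi k hk).le.trans hN)) (hv.le.trans hN)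
      · rw [Nat.succ_mul] at hum; omega
    rw [foldCap_cons, hf, Bool.false_or, if_neg (by simpa using hμ)]
    -- the round runs
    obtain ⟨haT, haw⟩ := hal a (by simp)
    have hIa : TInv C Sd acc.1.1 := hI.of_extends hinv.ext
    have hρa : EnvValid acc.1.1 ((v, a) :: ρ) :=
      (hρ.mono hinv.ext.length_le).cons (haT.trans_le hinv.ext.length_le)
    have henv : envOf C.n acc.1.1 ((v, a) :: ρ) = Function.update (envOf C.n T₀ ρ) v (val C.n T₀ a) := by
      rw [envOf_cons, hinv.ext.envOf_eq hρ hI.canon, hinv.ext.val_eq haT]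
    have hσa : EnvBound Y' (envOf C.n acc.1.1 ((v, a) :: ρ)) := by
      rw [henv]; exact hσ.update hYY' v haw
    obtain ⟨hfd, hld, hud⟩ := hR _ _ Y' m' hf hIa hA hρa hσa (hSd.mono hYY') (hn.trans hYY') hN
      (le_of_add_le_right hB)
    have hstep : forallStep C v R ρ a acc = ((den C R ((v, a) :: ρ) acc.1).1, acc.2 ++ (den C R ((v, a) :: ρ) acc.1).2) := rfl
    obtain ⟨hxd, -, -⟩ := hRs _ _ hfd hIa hρa
    have hinv' := forallInv_step hRs hI hρ hinv haT (by rw [hstep]; exact hfd)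
    have hsyn' : ∀ c ∈ (forallStep C v R ρ a acc).2, c.1.1 ≤ symB R ∧ c.1.2.length ≤ arB R := by
      intro c hc
      rw [hstep] at hc
      simp only [List.mem_append] at hc
      exact hc.elim (hsyn c) (den_syntactic C R _ _ c)
    obtain ⟨hf2, hl2, hu2⟩ := noOvf_forallFold hR hRs hI hρ hYY' hσ hSd hn hB L hL hm' l _ (done ++ [a])
      hinv' (by rw [hstep]; exact hfd) (by rw [hstep]; exact hA.of_extends hIa.canon hxd)
      (fun x hx => hal x (by simp [hx]))
      (by rw [hstep]; simp only [List.length_append, List.length_singleton, Nat.succ_mul]; omega)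
      (by rw [hstep]; simp only [List.length_append, List.length_singleton, Nat.succ_mul]; omega)
      hsyn' (by simp only [List.length_append, List.length_singleton]; omega)
    rw [hstep] at hl2 hu2 ⊢
    simp only [List.length_append, List.length_cons, Nat.succ_mul] at hl2 hu2 ⊢
    exact ⟨hf2, by omega, by omega⟩

/-- No overflow at a `do forall` rule. [folklore] -/
theorem noOvfR_forallDo {v : ℕ} {r : Term} {R : Rule} (hR : NoOvfR C Sd R) : NoOvfR C Sd (.forallDo v r R) := by
  intro ρ S Y m hf hI hA hρ hσ hSd hn hm hB
  rw [den_forallDo]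
  simp only [cntR, ucnt, gdR] at hB ⊢
  obtain ⟨hf1, hl1⟩ := noOvf_ev C Sd r ρ S Y m hf hI hA hρ hσ hSd hn hm (by omega)
  obtain ⟨hxr, hir, hvr⟩ := ev_sound C Sd r ρ S hf1 hI hρ
  have hIr : TInv C Sd (ev C r ρ S).1.1 := hI.of_extends hxr
  have hρr : EnvValid (ev C r ρ S).1.1 ρ := hρ.mono hxr.length_le
  have hσr : EnvBound Y (envOf C.n (ev C r ρ S).1.1 ρ) := by rwa [hxr.envOf_eq hρ hI.canon]
  have hYY' : Y ≤ wB r Y := le_wB r Y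
  have hwr : (val C.n (ev C r ρ S).1.1 (ev C r ρ S).2).hw ≤ wB r Y := by
    rw [hvr]; exact hw_eval_le r Y _ hσ hSd hn
  have hL : (elems C.n (ev C r ρ S).1.1 (ev C r ρ S).2).length ≤ wB r Y := by
    rw [← hxr.canon.card_members_val hir]
    exact (HF.card_members_le_hw _).trans hwr
  have hal : ∀ a ∈ elems C.n (ev C r ρ S).1.1 (ev C r ρ S).2,
      a < (ev C r ρ S).1.1.length ∧ (val C.n (ev C r ρ S).1.1 a).hw ≤ wB r Y := fun a ha =>
    ⟨(hxr.canon.lt_of_mem_elems hir ha).trans hir,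
      (HF.hw_le_of_mem ((hxr.canon.mem_elems_iff hir a).mp ha).2).trans hwr⟩
  have h0 : ForallInv C Sd v R (envOf C.n (ev C r ρ S).1.1 ρ) (ev C r ρ S).1.1 ((ev C r ρ S).1, []) [] :=
    ⟨Extends.refl hxr.canon, fun c hc => by simp at hc, fun u => by simp⟩
  have hml := Nat.mul_le_mul_right (cntR R (wB r Y)) hL
  have hmu := Nat.mul_le_mul_right (ucnt R (wB r Y)) hL
  obtain ⟨hf2, hl2, hu2⟩ := noOvf_forallFold hR (den_sound C Sd R) hIr hρr hYY' hσr hSd hn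
    (m' := m + cntT r Y + wB r Y * cntR R (wB r Y)) (by omega) _ hL
    (by omega) _ ((ev C r ρ S).1, []) [] h0 hf1 (hA.of_extends hI.canon hxr) hal (by simp) (by simp)
    (by simp) (by simp)
  dsimp only at hl2 hu2
  simp only [List.length_nil, Nat.zero_add] at hu2
  exact ⟨hf2, by omega, hu2.trans hmu⟩

variable (C Sd)

/-- **No overflow in `den`** (all rules). [Blass–Gurevich–Shelah 1999, §5.2 (proof of Thm 1)]
[folklore] -/
theorem noOvf_den : ∀ R : Rule, NoOvfR C Sd R
  | .skip => noOvfR_skip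
  | .update f args t => noOvfR_update f args t
  | .cond _ R₁ R₂ => noOvfR_cond (noOvf_den R₁) (noOvf_den R₂)
  | .forallDo _ _ R => noOvfR_forallDo (noOvf_den R)

end NoOvfRules

/-! ### No overflow: rounds and the run -/

/-- Bound on the round state (table `≤ M`, at most `S` state entries of code `≤ ub`).
[folklore] -/
def μRB (M S ub : ℕ) : ℕ := cP (tsB M) (cP (S * (2 * ub + 2)) (cP (M * (2 * 1 + 2)) 4))

/-- **The budget** of the simulation of `(Π, p, q)` on `n` atoms: it dominates the measure of
every round state and every guard bound inside a round. An explicit polynomial expression in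
`n`, `p(n)`, `q(n)`. [Blass–Gurevich–Shelah 1999, §5.2 Theorem 1] [folklore] -/
def budget (P : CPTCardProgram) (n : ℕ) : ℕ :=
  μRB (n + 2 + P.stepBound.eval n * cntR P.prog.rule (P.activeBound.eval n + n))
      (P.stepBound.eval n * ucnt P.prog.rule (P.activeBound.eval n + n))
      (uB (symB P.prog.rule) (arB P.prog.rule)
        (n + 2 + P.stepBound.eval n * cntR P.prog.rule (P.activeBound.eval n + n))) +
    gdR P.prog.rule (P.activeBound.eval n + n)
      (n + 2 + P.stepBound.eval n * cntR P.prog.rule (P.activeBound.eval n + n))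

/-- Length of a disjunction of masks. [folklore] -/
@[simp] theorem length_orMask (N : ℕ) (a b : List Bool) : (orMask N a b).length = N := by
  simp [orMask]

/-- The fired coded state is not longer than updates plus old state. [folklore] -/
theorem length_fireS_le (n : ℕ) (srep ups : List CUpdate) :
    (fireS n srep ups).length ≤ ups.length + srep.length := by
  unfold fireS
  split
  · rw [List.length_append]
    exact Nat.add_le_add (List.length_filter_le _ _) (List.length_filter_le _ _)
  · omega

/-- Entries of the fired coded state are updates or old entries. [folklore] -/
theorem mem_fireS {n : ℕ} {srep ups : List CUpdate} {e : CUpdate} (h : e ∈ fireS n srep ups) :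
    e ∈ ups ∨ e ∈ srep := by
  unfold fireS at h
  split at h
  · rcases List.mem_append.mp h with h | h
    · exact Or.inl (List.mem_filter.mp h).1
    · exact Or.inr (List.mem_filter.mp h).1
  · exact Or.inr h

/-- `statusOf` is at most `4`. [folklore] -/
theorem statusOf_le (n o : ℕ) : statusOf n o ≤ 4 := by
  unfold statusOf; split_ifs <;> omega


section Run

variable (R : Rule) (n : ℕ) (Y : ℕ)

/-- **Size invariant of the round state after `k` rounds.** [folklore] -/
structure RSz (k : ℕ) (st : RS) : Prop where
  /-- the flag is down -/
  flag : st.1.2 = false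
  /-- the table is canonical -/
  canon : Canon n st.1.1
  /-- atom entries are empty -/
  atoms : AtomsNil n st.1.1
  /-- the table has grown by at most `cntR` per round -/
  tlen : st.1.1.length ≤ n + 2 + k * cntR R Y
  /-- at most `ucnt` state entries per round -/
  slen : st.2.1.length ≤ k * ucnt R Y
  /-- state entries carry the rule's symbols and arities and valid indices -/
  sbd : ∀ e ∈ st.2.1, (e.1.1 ≤ symB R ∧ e.1.2.length ≤ arB R) ∧
    (e.2 < st.1.1.length ∧ ∀ k ∈ e.1.2, k < st.1.1.length)
  /-- the mask is not longer than the table -/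
  alen : st.2.2.1.length ≤ st.1.1.length
  /-- the status is at most `4` -/
  status : st.2.2.2 ≤ 4

variable {R n Y}

/-- The initial round state. [folklore] -/
theorem rSz_initRS : RSz R n Y 0 (initRS n) :=
  ⟨rfl, canon_initTab n, atomsNil_initTab n, by simp [initRS], by simp [initRS], by simp [initRS],
    by simp [initRS], by simp [initRS]⟩

/-- **The measure of a round state within the size invariant** (for `k ≤ pn`). [folklore] -/
theorem μR_le {k pn : ℕ} {st : RS} (h : RSz R n Y k st) (hk : k ≤ pn) :
    μR st ≤ μRB (n + 2 + pn * cntR R Y) (pn * ucnt R Y) (uB (symB R) (arB R) (n + 2 + pn * cntR R Y)) := by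
  have hM : st.1.1.length ≤ n + 2 + pn * cntR R Y :=
    h.tlen.trans (Nat.add_le_add_left (Nat.mul_le_mul_right _ hk) _)
  unfold μR μRB
  refine cP_le_cP (cTS_le h.canon h.atoms hM) (cP_le_cP ?_ (cP_le_cP ?_ (cN_le h.status)))
  · refine cUL_le (fun c hc => ?_) (h.slen.trans (Nat.mul_le_mul_right _ hk))
    obtain ⟨⟨h1, h2⟩, hv, hi⟩ := h.sbd c hc
    exact cU_le h1 h2 (fun k hk => (hi k hk).le.trans hM) (hv.le.trans hM)
  · exact (h.alen.trans hM).trans (Nat.le_mul_of_pos_right _ (by decide))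

/-- **One round keeps the size invariant** (given the census/simulation invariant when running,
and a budget dominating the rule's guard bound). [Blass–Gurevich–Shelah 1999, §5.2 (proof of
Thm 1: polynomial work per transition)] [folklore] -/
theorem rSz_round {Pr : Program} {B : ℕ} {adj : List Bool} {qn pn k : ℕ} {st : RS}
    (h : RSz R n Y k st) (hk : k ≤ pn) (hY : qn + n ≤ Y)
    (hinv : st.2.2.2 = 0 → RInv Pr n adj k st)
    (hB : gdR R Y (n + 2 + pn * cntR R Y) ≤ B) :
    RSz R n Y (k + 1) (round R B n adj qn st) := by
  have htl : st.1.1.length ≤ n + 2 + (k + 1) * cntR R Y := h.tlen.trans (by rw [Nat.succ_mul]; omega)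
  have hsl : st.2.1.length ≤ (k + 1) * ucnt R Y := h.slen.trans (by rw [Nat.succ_mul]; omega)
  unfold round
  by_cases h0 : st.2.2.2 = 0
  · rw [h0]
    simp only [beq_self_eq_true, Bool.not_true, Bool.false_eq_true, ↓reduceIte]
    split
    · -- abort: only the mask and status change
      exact ⟨h.flag, h.canon, h.atoms, htl, hsl, h.sbd, by simp, by simp⟩
    · rename_i hcensus
      split
      · -- halted
        exact ⟨h.flag, h.canon, h.atoms, htl, hsl, h.sbd, by simp, statusOf_le _ _⟩
      · -- running: one step within budget
        have hRI := hinv h0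
        simp only [decide_eq_true_eq, not_lt] at hcensus
        -- the census bound gives the width of the state
        have hrep : MaskRep n st.1.1 (orMask st.1.1.length st.2.2.1 (activeMask n st.1.1 st.2.1))
            (Pr.activeSet (TwoColouring.graph n adj) k) := by
          rw [← prevActive_union]
          exact hRI.mask.orMask (maskRep_activeMask h.canon hRI.srel)
        have hq : (Pr.activeSet (TwoColouring.graph n adj) k).encard ≤ qn := by
          rw [hrep.encard_eq h.canon]; exact_mod_cast hcensus
        have hSd : StBound Y (Pr.stateAt (TwoColouring.graph n adj) k) :=
          (stBound_of_encard_le hq).mono (by omega)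
        set C : Ctx := ⟨B, n, adj, st.2.1⟩
        have hI : TInv C (Pr.stateAt (TwoColouring.graph n adj) k) st.1.1 := ⟨h.canon, hRI.srel⟩
        have hσ : EnvBound Y (envOf n st.1.1 []) := by
          intro v; rw [envOf_nil h.canon]; simp
        have hm : st.1.1.length ≤ n + 2 + pn * cntR R Y :=
          h.tlen.trans (Nat.add_le_add_left (Nat.mul_le_mul_right _ hk) _)
        obtain ⟨hfd, hld, hud⟩ := noOvf_den C _ R [] st.1 Y _ h.flag hI h.atoms (fun p hp => by simp at hp)
          hσ hSd (by show n ≤ Y; omega) hm hB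
        obtain ⟨hxd, hvd, -⟩ := den_sound C _ R [] st.1 hfd hI (fun p hp => by simp at hp)
        refine ⟨hfd, hxd.canon, h.atoms.of_extends h.canon hxd, ?_, ?_, ?_, ?_, by simp⟩
        · exact hld.trans (by rw [Nat.succ_mul]; have := h.tlen; omega)
        · refine (length_fireS_le _ _ _).trans ?_
          rw [Nat.succ_mul]; have := h.slen; omega
        · intro e he
          rcases mem_fireS he with he | he
          · exact ⟨den_syntactic C R _ _ e he, hvd e he⟩
          · obtain ⟨hs, hv, hi⟩ := h.sbd e he
            exact ⟨hs, hv.trans_le hxd.length_le, fun k hk => (hi k hk).trans_le hxd.length_le⟩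
        · simp only [length_orMask]
          exact hxd.length_le
  · have : (!(st.2.2.2 == 0)) = true := by simpa using h0
    rw [if_pos this]
    exact ⟨h.flag, h.canon, h.atoms, htl, hsl, h.sbd, h.alen, h.status⟩

/-- **The run stays within budget**: after `j ≤ pn + 1` rounds the flag is down and the size
invariant holds. [Blass–Gurevich–Shelah 1999, §5.2 Theorem 1] [folklore] -/
theorem rSz_run (Pr : Program) {B : ℕ} (adj : List Bool) {qn pn : ℕ} (hY : qn + n ≤ Y)
    (hB : μRB (n + 2 + pn * cntR Pr.rule Y) (pn * ucnt Pr.rule Y)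
      (uB (symB Pr.rule) (arB Pr.rule) (n + 2 + pn * cntR Pr.rule Y)) +
        gdR Pr.rule Y (n + 2 + pn * cntR Pr.rule Y) ≤ B) :
    ∀ j, j ≤ pn + 1 →
      RSz Pr.rule n Y j (foldCap μR B (fun (_ : Unit) st => round Pr.rule B n adj qn st) (initRS n)
        (List.replicate j ())) := by
  intro j
  induction j with
  | zero => intro _; exact rSz_initRS
  | succ j ih =>
    intro hj
    have h := ih (Nat.le_of_succ_le hj)
    have hjp : j ≤ pn := Nat.le_of_lt_succ hj
    rw [List.replicate_succ', foldCap_append_singleton, h.flag, Bool.false_or,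
      if_neg (by simpa using ((μR_le h hjp).trans (le_of_add_le_left hB)))]
    refine rSz_round (Pr := Pr) h hjp hY (fun _ => ?_) (le_of_add_le_right hB)
    exact ((run_sim Pr B n adj qn j h.flag).2) (by
      obtain ⟨hstat, -⟩ := run_sim Pr B n adj qn j h.flag
      omega)

/-- **No overflow.** With the budget `budget P n` the overflow flag of the simulation of
`(Π, p, q)` on any adjacency data over `n` atoms is down at the end. [Blass–Gurevich–Shelah 1999,
§5.2 Theorem 1] [folklore] -/
theorem runP_flag (P : CPTCardProgram) (n : ℕ) (adj : List Bool) : (runP P (budget P n) n adj).1.2 = false :=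
  (rSz_run (Y := P.activeBound.eval n + n) P.prog adj le_rfl le_rfl _ le_rfl).flag

/-- **The simulation is correct.** With the budget `budget P n`, the status of `runP` is `1` iff
the bounded program accepts the graph coded by `(n, adj)`, and `2` iff it rejects it.
[Blass–Gurevich–Shelah 1999, §5.2 Theorem 1] [folklore] -/
theorem runP_status_iff (P : CPTCardProgram) (n : ℕ) (adj : List Bool) :
    ((runP P (budget P n) n adj).2.2.2 = 1 ↔ P.Accepts ⟨n, TwoColouring.graph n adj⟩) ∧
      ((runP P (budget P n) n adj).2.2.2 = 2 ↔ P.Rejects ⟨n, TwoColouring.graph n adj⟩) :=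
  runP_sound P (budget P n) n adj (runP_flag P n adj)

end Run

end Sim

end BGS

end Literature.ModelTheory.FiniteModelTheory
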